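import Summits.QuantumFields.YangMills.Theorems.ForcedResponseSkewnessRunningCouplingCeilingUniformSmear
import HarnessLib

/-!
# Crux `RunningCouplingCeiling` (repaired: stmt-QuantumFields-24275), line `pointwise-log-ceiling`: the uniform smearing
# step needs the kernel bounds only LOCALLY — at physical separations `t·d ≤ ℓ`

Support file (`--supports stmt-QuantumFields-24275`) by the width prover `ym-line-frs-p3` of route `ForcedResponseSkewness`
(lead `ym-line-frs-p1`); sequel of `…RunningCouplingCeilingUniformSmear`.

Observation (free on the analysis side, cheaper on the physics side): in `uniform_smear` a pair charged by `θv ⊗ v`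
(`tsupport v ⊆ closedBall p ρ₀`) has torus distance `d` with `d·s ≤ 2R`, `R = ‖p‖ + |ρ₀| + 1`, `s = l t ≥ 2t`, hence PHYSICAL
separation `t·d ≤ R`; and the bounded clause `|K| ≤ C₂` of `KernelBounds` is never used.  So the smeared ceiling holds under
the LOCAL kernel bounds

  `n₀ ≤ d → t·d ≤ ℓ → d⁸|K x y| ≤ C₁`  and  `n₀ ≤ d → t·d ≤ ½ → d⁸|K x y| ≤ C₀ / log²(1/(t d))`   (all `x, y ∈ box L`)

for any locality radius `ℓ ≥ 2R` — i.e. the physics half of the line owes the scale-free hyperscaling bound `d⁸|Cov| ≤ C₁`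
only up to a FIXED physical separation `ℓ` (E0′/`MomentBounds`-class, collar radius `≲ ℓ/a(β)`), not at all torus
distances (which would be a power-law CLUSTERING statement at arbitrarily large physical separation — IR/gap-class), and no
separate bounded clause.

* `pair_bound_local` — the per-pair bound under the local kernel bounds;
* `uniform_smear_local` — `∃ C ∀ v (tsupport v ⊆ closedBall p ρ₀, ∫|v| ≤ 1) ∀ Λ ≥ 2 ∃ t₀ > 0, Λ₆ ∀ 0 < t ≤ t₀ ∀ L (Λ₆ ≤ t·L)
  ∀ K with the LOCAL kernel bounds at radius ℓ ≥ 2(‖p‖ + |ρ₀| + 1) ∀ l ∈ [Λ, 2Λ]: Σ_{x,y} θv(l t x) v(l t y) K x y ≤ C/log²Λ`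
  (same constant `C = 4(4C₀⁺ + C₁⁺ log²(4R²))/(2(p₀−ρ₀))⁸` as `uniform_smear`).

Honest label: bookkeeping/analysis for a CONDITIONAL rung line (leaf R2a `BalabanLadder.NT`); the kernel bounds themselves
(Bałaban-class running-coupling decay of the dens–dens covariance below the unit + hyperscaling at fixed physical separation)
are NOT proved here; nothing in this file bears on the Yang–Mills mass gap, which is NOT proved by any of this.
-/

set_option autoImplicit false

noncomputable section

namespace Summit.QuantumFields.YangMills.Cruxes.RunningCouplingCeiling.Pointwise

open Set Metric Filter Topology Finset MeasureTheory
open scoped SchwartzMap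
open Literature.MathematicalPhysics.QuantumLattice Literature.Probability.LatticeModels
open Summit.QuantumFields.YangMills.Cruxes.NT.CeilingPrice (integral_abs_thetaTest)
open Summit.QuantumFields.YangMills.Cruxes.NT.Reference (tsupport_thetaTest_subset_closedBall_zero)

/-- **The per-pair bound under LOCAL kernel bounds.**  As `pair_bound`, but the scale-free clause is assumed only for
physical separations `t·d ≤ ℓ` with `ℓ ≥ 2R` and no bounded clause is assumed: a charged pair has `t·d = d s/l ≤ 2R/Λ ≤ R`.
[folklore] -/
theorem pair_bound_local {v : 𝓢(EuclideanSpace ℝ (Fin 4), ℝ)} {p : EuclideanSpace ℝ (Fin 4)} {ρ₀ : ℝ}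
    (hv : tsupport (v : EuclideanSpace ℝ (Fin 4) → ℝ) ⊆ closedBall p ρ₀) {C₀ C₁ ℓ : ℝ} {n₀ : ℕ} {t : ℝ}
    {L : ℕ} {K : (Fin 4 → ℤ) → (Fin 4 → ℤ) → ℝ}
    (hK : ∀ x ∈ box 4 L, ∀ y ∈ box 4 L,
      (((n₀ : ℝ) ≤ torusDist L x y → t * torusDist L x y ≤ ℓ → torusDist L x y ^ 8 * |K x y| ≤ C₁) ∧
       ((n₀ : ℝ) ≤ torusDist L x y → t * torusDist L x y ≤ 1 / 2 →
          torusDist L x y ^ 8 * |K x y| ≤ C₀ / Real.log (1 / (t * torusDist L x y)) ^ 2)))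
    {R Λ l s : ℝ} (hR1 : 1 ≤ R) (hρR : ‖p‖ + ρ₀ ≤ R) (hℓ : 2 * R ≤ ℓ) (hΛ : 2 ≤ Λ) (hl1 : Λ ≤ l) (ht : 0 < t)
    (hs : s = l * t) (hsδ : s * ((n₀ : ℝ) + 1) ≤ p 0 - ρ₀) (h2RsL : 2 * R ≤ s * L) {x y : Fin 4 → ℤ}
    (hx : x ∈ box 4 L) (hy : y ∈ box 4 L) :
    thetaTest 4 v (s • siteToE x) * v (s • siteToE y) * K x y ≤
      |thetaTest 4 v (s • siteToE x)| * |v (s • siteToE y)| *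
        ((4 * max C₀ 0 + max C₁ 0 * Real.log (4 * R ^ 2) ^ 2) / (2 * (p 0 - ρ₀)) ^ 8 * s ^ 8 /
          Real.log Λ ^ 2) := by
  have hl0 : 0 < l := by linarith
  have hs0 : 0 < s := by rw [hs]; exact mul_pos hl0 ht
  have hδ : 0 < p 0 - ρ₀ := lt_of_lt_of_le (by positivity) hsδ
  have hM : 0 ≤ (4 * max C₀ 0 + max C₁ 0 * Real.log (4 * R ^ 2) ^ 2) / (2 * (p 0 - ρ₀)) ^ 8 :=
    div_nonneg (add_nonneg (mul_nonneg (by norm_num) (le_max_right _ _))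
      (mul_nonneg (le_max_right _ _) (sq_nonneg _))) (pow_nonneg (by linarith) 8)
  have hc : 0 ≤ (4 * max C₀ 0 + max C₁ 0 * Real.log (4 * R ^ 2) ^ 2) / (2 * (p 0 - ρ₀)) ^ 8 * s ^ 8 /
      Real.log Λ ^ 2 := div_nonneg (mul_nonneg hM (pow_nonneg hs0.le 8)) (sq_nonneg _)
  by_cases hzero : thetaTest 4 v (s • siteToE x) * v (s • siteToE y) = 0
  · rw [hzero, zero_mul]
    exact mul_nonneg (mul_nonneg (abs_nonneg _) (abs_nonneg _)) hc
  obtain ⟨hx0, hy0⟩ := mul_ne_zero_iff.1 hzero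
  obtain ⟨hx1, hx2, hy1, hy2, hxR, hyR⟩ := pair_coords hv hx0 hy0
  have hp0 : p 0 ≤ ‖p‖ := by
    have h := PiLp.norm_apply_le p (0 : Fin 4)
    rw [Real.norm_eq_abs] at h
    exact (le_abs_self _).trans h
  have hsplit : s * ((y 0 : ℝ) - x 0) = s * y 0 + -(s * x 0) := by ring
  have hlow : 2 * (p 0 - ρ₀) ≤ s * ((y 0 : ℝ) - x 0) := by rw [hsplit]; linarith
  have hup : s * ((y 0 : ℝ) - x 0) ≤ 2 * R := by rw [hsplit]; linarith
  obtain ⟨hd1, hd2⟩ := pair_torusDist hs0 hδ hlow hup (hxR.trans hρR) (hyR.trans hρR) h2RsL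
  have hd0 : 0 < torusDist L x y := by
    by_contra h
    rw [not_lt] at h
    have hd00 : torusDist L x y = 0 := le_antisymm h (torusDist_nonneg L x y)
    rw [hd00, zero_mul] at hd1
    linarith
  have hdn₀ : (n₀ : ℝ) ≤ torusDist L x y := by
    have h1 : (n₀ : ℝ) * s ≤ torusDist L x y * s := by
      calc (n₀ : ℝ) * s ≤ ((n₀ : ℝ) + 1) * s := mul_le_mul_of_nonneg_right (by linarith) hs0.le
        _ = s * ((n₀ : ℝ) + 1) := mul_comm _ _
        _ ≤ p 0 - ρ₀ := hsδ
        _ ≤ 2 * (p 0 - ρ₀) := by linarith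
        _ ≤ torusDist L x y * s := hd1
    exact le_of_mul_le_mul_right h1 hs0
  -- the physical separation of a charged pair: `t·d = d s / l ≤ 2R/Λ ≤ R ≤ ℓ`
  have htd : t * torusDist L x y ≤ ℓ := by
    have h1 : t * torusDist L x y * l = torusDist L x y * s := by rw [hs]; ring
    have h2 : t * torusDist L x y * l ≤ 2 * R := by rw [h1]; exact hd2
    have h3 : t * torusDist L x y * 2 ≤ t * torusDist L x y * l :=
      mul_le_mul_of_nonneg_left (by linarith) (mul_pos ht hd0).le
    linarith
  obtain ⟨hK1, hK0⟩ := hK x hx y hy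
  have hKlog := kernel_mul_log_sq_le hR1 hΛ hl1 hs ht hd0 hδ hd1 hd2 (abs_nonneg (K x y)) (hK1 hdn₀ htd)
    (hK0 hdn₀)
  have hlogΛ : 0 < Real.log Λ := Real.log_pos (by linarith)
  have hKle : |K x y| ≤ (4 * max C₀ 0 + max C₁ 0 * Real.log (4 * R ^ 2) ^ 2) / (2 * (p 0 - ρ₀)) ^ 8 * s ^ 8 /
      Real.log Λ ^ 2 := by
    rw [le_div_iff₀ (by positivity)]
    linarith
  calc thetaTest 4 v (s • siteToE x) * v (s • siteToE y) * K x y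
      ≤ |thetaTest 4 v (s • siteToE x) * v (s • siteToE y) * K x y| := le_abs_self _
    _ = |thetaTest 4 v (s • siteToE x)| * |v (s • siteToE y)| * |K x y| := by rw [abs_mul, abs_mul]
    _ ≤ _ := mul_le_mul_of_nonneg_left hKle (mul_nonneg (abs_nonneg _) (abs_nonneg _))

/-- **Smeared ceiling from LOCAL pointwise kernel bounds, UNIFORM over `L¹`-normalised sources in a positive-time ball.**
For all `C₀ C₁ n₀`, every ball `closedBall p ρ₀` with `ρ₀ < p₀` and every locality radius `ℓ ≥ 2(‖p‖ + |ρ₀| + 1)` there is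
`C` such that: for every real Schwartz `v` with `tsupport v ⊆ closedBall p ρ₀`, `∫|v| ≤ 1` and every `Λ ≥ 2` there are
`t₀ > 0`, `Λ₆` with — for all `0 < t ≤ t₀`, all `L` with `Λ₆ ≤ t·L`, every kernel `K` obeying the LOCAL bounds
`n₀ ≤ d → t d ≤ ℓ → d⁸|K x y| ≤ C₁` and `n₀ ≤ d → t d ≤ ½ → d⁸|K x y| ≤ C₀/log²(1/(t d))` (`d` the torus distance,
`x, y ∈ box L`), and every `l ∈ [Λ, 2Λ]` — `Σ_{x,y ∈ box L} θv(l t·x) v(l t·y) K x y ≤ C / log²Λ`. [folklore] -/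
theorem uniform_smear_local (C₀ C₁ : ℝ) (n₀ : ℕ) (p : EuclideanSpace ℝ (Fin 4)) (ρ₀ : ℝ) (hp : ρ₀ < p 0)
    (ℓ : ℝ) (hℓ : 2 * (‖p‖ + |ρ₀| + 1) ≤ ℓ) :
    ∃ C : ℝ, ∀ v : 𝓢(EuclideanSpace ℝ (Fin 4), ℝ),
      tsupport (v : EuclideanSpace ℝ (Fin 4) → ℝ) ⊆ closedBall p ρ₀ → (∫ y, |v y|) ≤ 1 →
      ∀ Λ : ℝ, 2 ≤ Λ → ∃ t₀ Λ₆ : ℝ, 0 < t₀ ∧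
        ∀ t : ℝ, 0 < t → t ≤ t₀ → ∀ L : ℕ, Λ₆ ≤ t * L →
          ∀ K : (Fin 4 → ℤ) → (Fin 4 → ℤ) → ℝ,
            (∀ x ∈ box 4 L, ∀ y ∈ box 4 L,
              (((n₀ : ℝ) ≤ torusDist L x y → t * torusDist L x y ≤ ℓ → torusDist L x y ^ 8 * |K x y| ≤ C₁) ∧
               ((n₀ : ℝ) ≤ torusDist L x y → t * torusDist L x y ≤ 1 / 2 →
                  torusDist L x y ^ 8 * |K x y| ≤ C₀ / Real.log (1 / (t * torusDist L x y)) ^ 2))) →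
            ∀ l : ℝ, l ∈ Set.Icc Λ (2 * Λ) →
              ∑ x ∈ box 4 L, ∑ y ∈ box 4 L,
                (thetaTest 4 v) ((l * t) • siteToE x) * v ((l * t) • siteToE y) * K x y ≤
                  C / Real.log Λ ^ 2 := by
  -- constants: wall gap `δ`, support radius `R ≥ 1`, kernel constant `M`
  have hδ : 0 < p 0 - ρ₀ := by linarith
  set R : ℝ := ‖p‖ + |ρ₀| + 1 with hR_def
  have hR1 : 1 ≤ R := by rw [hR_def]; linarith [norm_nonneg p, abs_nonneg ρ₀]
  have hρR : ‖p‖ + ρ₀ ≤ R := by rw [hR_def]; linarith [le_abs_self ρ₀]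
  set M : ℝ := (4 * max C₀ 0 + max C₁ 0 * Real.log (4 * R ^ 2) ^ 2) / (2 * (p 0 - ρ₀)) ^ 8 with hM_def
  have hM : 0 ≤ M :=
    div_nonneg (add_nonneg (mul_nonneg (by norm_num) (le_max_right _ _))
      (mul_nonneg (le_max_right _ _) (sq_nonneg _))) (pow_nonneg (by linarith) 8)
  refine ⟨4 * M, fun v hv hint Λ hΛ => ?_⟩
  -- supports of `v`, `θv` inside `closedBall 0 R`; Riemann thresholds for `|v|`, `|θv|`
  have hvR : tsupport (v : EuclideanSpace ℝ (Fin 4) → ℝ) ⊆ closedBall 0 R :=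
    hv.trans (closedBall_subset_closedBall' (by rw [dist_zero_right]; linarith))
  have hθvR : tsupport (thetaTest 4 v : EuclideanSpace ℝ (Fin 4) → ℝ) ⊆ closedBall 0 R :=
    tsupport_thetaTest_subset_closedBall_zero hvR
  obtain ⟨s₁, hs₁, h₁⟩ := exists_latticeSum_abs_le v hvR
  obtain ⟨s₂, hs₂, h₂⟩ := exists_latticeSum_abs_le (thetaTest 4 v) hθvR
  have hθint : (∫ y, |thetaTest 4 v y|) ≤ 1 := by rw [integral_abs_thetaTest]; exact hint
  have hΛ0 : 0 < Λ := by linarith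
  -- thresholds: `s = l t ≤ 2Λ t₀ = min (min s₁ s₂) (δ/(n₀+1))`, tori `t·L ≥ R`
  set m : ℝ := min (min s₁ s₂) ((p 0 - ρ₀) / (n₀ + 1)) with hm_def
  have hm0 : 0 < m := lt_min (lt_min hs₁ hs₂) (div_pos hδ (by positivity))
  refine ⟨m / (2 * Λ), R, div_pos hm0 (by positivity), fun t ht htt₀ L hL K hK l hl => ?_⟩
  obtain ⟨hl1, hl2⟩ := hl
  have hl0 : 0 < l := by linarith
  have hs : 0 < l * t := mul_pos hl0 ht
  have hsm : l * t ≤ m := by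
    calc l * t ≤ (2 * Λ) * (m / (2 * Λ)) := mul_le_mul hl2 htt₀ ht.le (by positivity)
      _ = m := by field_simp
  have hss₁ : l * t ≤ s₁ := hsm.trans ((min_le_left _ _).trans (min_le_left _ _))
  have hss₂ : l * t ≤ s₂ := hsm.trans ((min_le_left _ _).trans (min_le_right _ _))
  have hsδ : l * t * ((n₀ : ℝ) + 1) ≤ p 0 - ρ₀ := by
    have h := hsm.trans (min_le_right _ _)
    rwa [le_div_iff₀ (by positivity)] at h
  have hts : t ≤ l * t := by
    calc t = 1 * t := (one_mul t).symm
      _ ≤ l * t := mul_le_mul_of_nonneg_right (by linarith) ht.le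
  have hRsL : R ≤ l * t * L := hL.trans (mul_le_mul_of_nonneg_right hts (Nat.cast_nonneg L))
  have h2RsL : 2 * R ≤ l * t * L := by
    calc 2 * R ≤ 2 * (t * L) := by linarith
      _ = (2 * t) * L := by ring
      _ ≤ l * t * L := mul_le_mul_of_nonneg_right (mul_le_mul_of_nonneg_right (by linarith) ht.le)
          (Nat.cast_nonneg L)
  -- per-pair bound, summed and factorised
  have hsum := Finset.sum_le_sum fun x hx => Finset.sum_le_sum fun y hy =>
    pair_bound_local hv hK hR1 hρR hℓ hΛ hl1 ht rfl hsδ h2RsL hx hy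
  have hA := h₂ (l * t) hs hss₂ L hRsL
  have hB := h₁ (l * t) hs hss₁ L hRsL
  have hA2 : (l * t) ^ 4 * ∑ x ∈ box 4 L, |thetaTest 4 v ((l * t) • siteToE x)| ≤ 2 := by linarith
  have hB2 : (l * t) ^ 4 * ∑ y ∈ box 4 L, |v ((l * t) • siteToE y)| ≤ 2 := by linarith
  have hB0 : 0 ≤ (l * t) ^ 4 * ∑ y ∈ box 4 L, |v ((l * t) • siteToE y)| :=
    mul_nonneg (pow_nonneg hs.le 4) (Finset.sum_nonneg fun y _ => abs_nonneg _)
  have hlog2 : 0 < Real.log Λ ^ 2 := pow_pos (Real.log_pos (by linarith)) 2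
  refine hsum.trans ?_
  rw [sum_sum_abs_mul_abs_mul]
  calc (∑ x ∈ box 4 L, |thetaTest 4 v ((l * t) • siteToE x)|) * (∑ y ∈ box 4 L, |v ((l * t) • siteToE y)|) *
        (M * (l * t) ^ 8 / Real.log Λ ^ 2)
      = (M / Real.log Λ ^ 2) * (((l * t) ^ 4 * ∑ x ∈ box 4 L, |thetaTest 4 v ((l * t) • siteToE x)|) *
          ((l * t) ^ 4 * ∑ y ∈ box 4 L, |v ((l * t) • siteToE y)|)) := by ring
    _ ≤ (M / Real.log Λ ^ 2) * (2 * 2) := by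
        refine mul_le_mul_of_nonneg_left ?_ (div_nonneg hM hlog2.le)
        exact mul_le_mul hA2 hB2 hB0 (by norm_num)
    _ = 4 * M / Real.log Λ ^ 2 := by ring

end Summit.QuantumFields.YangMills.Cruxes.RunningCouplingCeiling.Pointwise

end
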